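import Mathlib
import Literature.Analysis.FluidPDE.ParticleTrajectoryFlow
import Literature.Analysis.FluidPDE.ParticleTrajectoryGradientBounds
import Literature.Analysis.FluidPDE.ParticleTrajectoryMeasurePreserving
import Literature.Analysis.FluidPDE.SpaceTimeCalculusC1
import Literature.Analysis.FluidPDE.TaoEnstrophyLocalisationProofs
import Summits.NavierStokesRegularity.NavierStokesRegularity.Theorems.PowerGaugeEulerLiouville.Negative.RelaxingEulerFlowEnergy
import Summits.NavierStokesRegularity.NavierStokesRegularity.Theorems.PowerGaugeEulerLiouville.Negative.VorticityMassEnergy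

/-!
# Crux `EulerZoomLiouville.PowerGaugeEulerLiouville` (stmt-NavierStokesRegularity-19832) —
# NO CLASSICAL EULER FLOW WITH INTEGRABLE VORTICITY IS RELAXING (the fat-vorticity door narrows to `ω₀ ∉ L¹`)

Negative-lane structure record (prover hand leafhand-ns-eulerzoomliouville-9 g0; `--supports` stmt-19832).  The forward
refutation door (F) of the crux (`…Negative.ForwardRelaxingClassicalFlow`: a nonzero global classical finite-energy Euler flow on
`(0,∞) × ℝ³` with square-summable enstrophy `∫₀^∞∫|∇v|²_F < ∞` and a pressure budget refutes X_E on `0 < ρ ≤ ½`) was closed by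
hand 8 for THIN vorticity (vortex volume `< ∞`, in particular compactly supported vorticity data:
`…Negative.VortexVolumeInvariant.no_relaxing_classicalEuler_of_compactVorticity`), leaving «fat, non-compact vorticity» as the
research residual.  This file closes the door for every datum with INTEGRABLE vorticity `curl u(0) ∈ L¹(ℝ³)` — fat or thin — by two
elementary facts:

* (kinematics) the **mass–enstrophy slaving of the energy**: `∫|K₃ ∗ ω|² ≤ C (∫|ω|)^{4/3} (∫|ω|²)^{1/3}` (Biot–Savart ≤ Riesz potential,
  Hardy–Littlewood–Sobolev `‖I₁Φ‖₂ ≤ C‖Φ‖_{6/5}`, and the interpolation `‖Φ‖_{6/5} ≤ ‖Φ‖₁^{2/3}‖Φ‖₂^{1/3}` in place of Hölder on the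
  support) — `vorticityMassEnergyIneq`, `energy_le_vorticityMass_enstrophy` of `…Negative.VorticityMassEnergy`;
* (dynamics) the **vorticity mass is controlled by the space–time enstrophy**: along a classical Euler flow on `[0,∞) × ℝ³` with
  Cauchy–Lipschitz velocity, `∫|ω(t)| ≤ ∫|ω₀| + 2∫₀ᵗ∫|∇u|²_F` (Cauchy formula `ω(X(α,t),t) = ∇_αX ω₀`, the equation of variation
  `d/dt ∇_αX ω₀ = ∇u(X) ∇_αX ω₀`, `|∇u(X)||ω(X)| ≤ 2|∇u(X)|²_F`, and the measure-preserving trajectory maps) —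
  `lintegral_enorm_curl_le_of_classical_euler`.

Hence (`no_relaxing_classicalEuler_of_integrableVorticity`): a classical Euler flow on `[0,∞) × ℝ³` with Cauchy–Lipschitz velocity,
`curl u(0) ∈ L¹`, the natural `L² ∩ L³ / |p||u|` slice budgets (energy conservation), positive energy at one time and finite-enstrophy
slices has `∫∫_{(0,∞)×ℝ³}|∇u|²_F = ∞`: with a finite budget `M` the vorticity mass stays `≤ ∫|ω₀| + 2M`, so the conserved energy
forces a uniform enstrophy floor on every slice, which is not summable.  What is left of door (F) on the classical side: data with
`u₀ ∈ L²`, `∇u₀ ∈ L²` but `curl u₀ ∉ L¹(ℝ³)` (vorticity tails between `|x|^{-5/2}` and `|x|^{-3}`).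

WHAT THIS IS NOT: not a refutation or proof of the crux, of a stub, or of the route; not a claim about Navier–Stokes.
[folklore; Stein1971 Ch. V §1.2 Thm 1 (b) and MajdaBertozziCUP2002 §1.6 Prop. 1.8, §4.2 (4.45) via the tree] -/

noncomputable section
set_option linter.dupNamespace false
namespace Summit.NavierStokesRegularity.NavierStokesRegularity.Theorems.PowerGaugeEulerLiouville.Negative

open MeasureTheory Set Function Filter Topology Metric Literature.Analysis Literature.Analysis.FluidPDE
  Literature.Analysis.SingularIntegrals
open scoped NNReal ENNReal

/-! ## Part B — the vorticity mass is controlled by the space–time enstrophy (Lagrangian bound) -/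

section Lagrangian

variable {u : ℝ → EuclideanSpace ℝ (Fin 3) → EuclideanSpace ℝ (Fin 3)} {p : ℝ → EuclideanSpace ℝ (Fin 3) → ℝ}

/-- **Pointwise Lagrangian bound.**  Classical Euler on `[0,∞) × ℝ³` with Cauchy–Lipschitz velocity, `X(·,t) = φ(t,0,·)` the
particle-trajectory map: for `t ≥ 0` and every label `α`,
`‖ω(X(α,t),t)‖ ≤ ‖ω₀(α)‖ + ∫₀ᵗ 2 |∇u(X(α,r),r)|²_F dr`
(Cauchy formula `ω(X(α,r),r) = ∇_αX(α,r) ω₀(α)`, equation of variation `d/dr ∇_αX ω₀ = ∇u(X) ∇_αX ω₀`, fundamental theorem of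
calculus, and `‖∇u(X)‖·‖ω(X)‖ ≤ 2|∇u(X)|²_F` from `‖L‖² ≤ |L|²_F`, `‖curl‖² ≤ 2|∇|²_F`).
[cite: MajdaBertozziCUP2002, §1.6 Prop. 1.8 eq. (1.51), §4.2 eq. (4.45)] -/
theorem norm_curl_evolutionMap_le_of_classical_euler (h : IsClassicalEulerSolutionOn (Ici (0 : ℝ)) 0 u p)
    (hL : ODE.IsUniformlyLipschitzOn u (Ici (0 : ℝ))) {t : ℝ} (ht : 0 ≤ t) (a : EuclideanSpace ℝ (Fin 3)) :
    ‖curl (u t) (ODE.evolutionMap u 0 t a)‖ ≤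
      ‖curl (u 0) a‖ + ∫ r in (0 : ℝ)..t, 2 * frobeniusNormSq (fderiv ℝ (u r) (ODE.evolutionMap u 0 r a)) := by
  have hS : Convex ℝ (Ici (0 : ℝ)) := convex_Ici 0
  have h0 : (0 : ℝ) ∈ Ici (0 : ℝ) := self_mem_Ici
  have hU : UniqueDiffOn ℝ (Ici (0 : ℝ)) := uniqueDiffOn_Ici 0
  have htS : t ∈ Ici (0 : ℝ) := ht
  set X : ℝ → EuclideanSpace ℝ (Fin 3) → EuclideanSpace ℝ (Fin 3) := fun r => ODE.evolutionMap u 0 r with hX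
  -- the transported vector `η(r) = ∇_αX(α,r) ω₀(α)` and the gradient along the trajectory
  set η : ℝ → EuclideanSpace ℝ (Fin 3) := fun r => fderiv ℝ (X r) a (curl (u 0) a) with hη
  set A : ℝ → EuclideanSpace ℝ (Fin 3) →L[ℝ] EuclideanSpace ℝ (Fin 3) := fun r => fderiv ℝ (u r) (X r a) with hA
  -- Cauchy formula: `ω(X(α,r),r) = η(r)`
  have hcauchy : ∀ r ∈ Ici (0 : ℝ), curl (u r) (X r a) = η r := fun r hr =>
    h.curl_evolutionMap hS h0 hU hL hr a
  -- equation of variation within `[0,∞)`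
  have hderivW : ∀ r ∈ Ici (0 : ℝ), HasDerivWithinAt η (A r (η r)) (Ici (0 : ℝ)) r := fun r hr =>
    hasDerivWithinAt_fderiv_evolutionMap_apply hL h.smooth_velocity hS hU h0 hr a (curl (u 0) a)
  have hηcont : ContinuousOn η (Icc 0 t) := fun r hr =>
    ((hderivW r hr.1).continuousWithinAt).mono Icc_subset_Ici_self
  have hderiv : ∀ r ∈ Ioo 0 t, HasDerivAt η (A r (η r)) r := fun r hr =>
    (hderivW r hr.1.le).hasDerivAt (Ici_mem_nhds hr.1)
  -- continuity of the gradient along the trajectory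
  have hgrad : ContinuousOn (fun q : ℝ × EuclideanSpace ℝ (Fin 3) => fderiv ℝ (u q.1) q.2)
      (Ici (0 : ℝ) ×ˢ univ) :=
    continuousOn_fderiv_slice_of_contDiffOn (h.smooth_velocity.of_le (by norm_cast)) hU
  have hXa : ContinuousOn (fun r => X r a) (Ici (0 : ℝ)) := hL.continuousOn_evolutionMap hS h0 a
  have hAcont : ContinuousOn A (Ici (0 : ℝ)) :=
    hgrad.comp (continuousOn_id.prodMk hXa) fun r hr => mk_mem_prod hr (mem_univ _)
  have hη'cont : ContinuousOn (fun r => A r (η r)) (Icc 0 t) :=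
    (hAcont.mono Icc_subset_Ici_self).clm_apply hηcont
  -- the integrand `2 |∇u(X(α,r),r)|²_F` is continuous on `[0,t]`
  have hFcont : ContinuousOn (fun r => 2 * frobeniusNormSq (A r)) (Icc 0 t) :=
    continuousOn_const.mul
      ((LerayHopfProofs.continuous_frobeniusNormSq.comp_continuousOn hAcont).mono Icc_subset_Ici_self)
  -- fundamental theorem of calculus
  have hFTC : ∫ r in (0 : ℝ)..t, A r (η r) = η t - η 0 :=
    intervalIntegral.integral_eq_sub_of_hasDerivAt_of_le ht hηcont hderiv
      (hη'cont.mono (by rw [uIcc_of_le ht])).intervalIntegrable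
  -- pointwise bound on the integrand
  have hpt : ∀ r ∈ Icc 0 t, ‖A r (η r)‖ ≤ 2 * frobeniusNormSq (A r) := by
    intro r hr
    have hrS : r ∈ Ici (0 : ℝ) := hr.1
    rw [← hcauchy r hrS]
    have h1 : ‖A r‖ ^ 2 ≤ frobeniusNormSq (A r) := sq_opNorm_le_frobeniusNormSq (A r)
    have h2 : ‖curl (u r) (X r a)‖ ^ 2 ≤ 2 * frobeniusNormSq (fderiv ℝ (u r) (X r a)) :=
      norm_curl_sq_le_two_mul_frobeniusNormSq (u r) (X r a)
    have h3 : ‖A r (curl (u r) (X r a))‖ ≤ ‖A r‖ * ‖curl (u r) (X r a)‖ := (A r).le_opNorm _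
    nlinarith [sq_nonneg (‖A r‖ - ‖curl (u r) (X r a)‖), norm_nonneg (A r), norm_nonneg (curl (u r) (X r a)),
      frobeniusNormSq_nonneg (A r)]
  -- `η 0 = ω₀(α)`
  have hη0 : η 0 = curl (u 0) a := by
    rw [← hcauchy 0 h0, hX]
    simp [ODE.evolutionMap_self]
  calc ‖curl (u t) (X t a)‖ = ‖η 0 + (η t - η 0)‖ := by rw [hcauchy t htS, add_sub_cancel]
    _ ≤ ‖η 0‖ + ‖η t - η 0‖ := norm_add_le _ _
    _ = ‖curl (u 0) a‖ + ‖∫ r in (0 : ℝ)..t, A r (η r)‖ := by rw [hFTC, hη0]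
    _ ≤ ‖curl (u 0) a‖ + ∫ r in (0 : ℝ)..t, ‖A r (η r)‖ := by
        gcongr; exact intervalIntegral.norm_integral_le_integral_norm ht
    _ ≤ ‖curl (u 0) a‖ + ∫ r in (0 : ℝ)..t, 2 * frobeniusNormSq (A r) := by
        gcongr
        exact intervalIntegral.integral_mono_on ht
          ((hη'cont.norm).mono (by rw [uIcc_of_le ht])).intervalIntegrable
          (hFcont.mono (by rw [uIcc_of_le ht])).intervalIntegrable hpt


/-- **THE VORTICITY MASS IS CONTROLLED BY THE SPACE–TIME ENSTROPHY.**  Classical Euler on `[0,∞) × ℝ³` with Cauchy–Lipschitz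
velocity: for every `t ≥ 0`,
`∫ ‖curl u(t)‖ ≤ ∫ ‖curl u(0)‖ + 2 ∫∫_{(0,t]×ℝ³} |∇u|²_F`
(in `[0,∞]`; integrate `norm_curl_evolutionMap_le_of_classical_euler` over the labels, the particle-trajectory maps preserve
Lebesgue measure, Tonelli).  In particular a finite space–time enstrophy budget keeps an integrable vorticity integrable, with a
uniform bound on its mass. [cite: MajdaBertozziCUP2002, §1.3 Prop. 1.4, §1.6 Prop. 1.8] -/
theorem lintegral_enorm_curl_le_of_classical_euler (h : IsClassicalEulerSolutionOn (Ici (0 : ℝ)) 0 u p)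
    (hL : ODE.IsUniformlyLipschitzOn u (Ici (0 : ℝ))) {t : ℝ} (ht : 0 ≤ t) :
    ∫⁻ x, ‖curl (u t) x‖ₑ ≤
      (∫⁻ a, ‖curl (u 0) a‖ₑ) +
        2 * ∫⁻ z in Ioc 0 t ×ˢ (univ : Set (EuclideanSpace ℝ (Fin 3))),
          ENNReal.ofReal (frobeniusNormSq (fderiv ℝ (u z.1) z.2)) := by
  have hS : Convex ℝ (Ici (0 : ℝ)) := convex_Ici 0
  have h0 : (0 : ℝ) ∈ Ici (0 : ℝ) := self_mem_Ici
  have hU : UniqueDiffOn ℝ (Ici (0 : ℝ)) := uniqueDiffOn_Ici 0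
  have htS : t ∈ Ici (0 : ℝ) := ht
  set X : ℝ → EuclideanSpace ℝ (Fin 3) → EuclideanSpace ℝ (Fin 3) := fun r => ODE.evolutionMap u 0 r with hX
  set F : ℝ → EuclideanSpace ℝ (Fin 3) → ℝ := fun r y => frobeniusNormSq (fderiv ℝ (u r) y) with hF
  set G : ℝ → EuclideanSpace ℝ (Fin 3) → ℝ≥0∞ := fun r y => ENNReal.ofReal (2 * F r y) with hG
  -- regularity
  have hC2 : ∀ r ∈ Ici (0 : ℝ), ContDiff ℝ 2 (u r) := fun r hr => (h.contDiff_velocity hr).of_le (by norm_cast)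
  have hgrad : ContinuousOn (fun q : ℝ × EuclideanSpace ℝ (Fin 3) => fderiv ℝ (u q.1) q.2)
      (Ici (0 : ℝ) ×ˢ univ) :=
    continuousOn_fderiv_slice_of_contDiffOn (h.smooth_velocity.of_le (by norm_cast)) hU
  have hXcont : ContinuousOn (fun q : ℝ × EuclideanSpace ℝ (Fin 3) => X q.1 q.2) (Ici (0 : ℝ) ×ˢ univ) :=
    (isSmoothSpaceTimeOn_evolutionMap hL h.smooth_velocity hS hU h0).continuousOn
  have hGcont : ContinuousOn (fun q : ℝ × EuclideanSpace ℝ (Fin 3) => G q.1 q.2) (Ici (0 : ℝ) ×ˢ univ) :=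
    ENNReal.continuous_ofReal.comp_continuousOn
      (continuousOn_const.mul (LerayHopfProofs.continuous_frobeniusNormSq.comp_continuousOn hgrad))
  -- `(r, α) ↦ G r (X r α)` and its swap `(α, r) ↦ G r (X r α)` are continuous (stated as compositions, to keep the
  -- elaborator away from higher-order unification)
  have hGXcont := hGcont.comp (continuousOn_fst.prodMk hXcont)
    (fun q hq => mk_mem_prod (mem_prod.1 hq).1 (mem_univ _))
  have hGXsw := hGXcont.comp (continuous_swap.continuousOn (s := (univ : Set (EuclideanSpace ℝ (Fin 3))) ×ˢ Ioc 0 t))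
    (fun q hq => mk_mem_prod (mem_Ici.2 (mem_prod.1 hq).2.1.le) (mem_univ _))
  have hGmeas : ∀ r ∈ Ici (0 : ℝ), Measurable (G r) := fun r hr =>
    ENNReal.measurable_ofReal.comp
      (continuous_const.mul
        (LerayHopfProofs.continuous_frobeniusNormSq.comp ((hC2 r hr).continuous_fderiv (by norm_num)))).measurable
  have hωmeas : ∀ r ∈ Ici (0 : ℝ), Measurable fun x => ‖curl (u r) x‖ₑ := fun r hr =>
    (continuous_curl ((hC2 r hr).of_le (by norm_num))).measurable.enorm
  -- measure preservation of the trajectory maps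
  have hmp : ∀ r ∈ Ici (0 : ℝ), MeasurePreserving (X r) volume volume := fun r hr =>
    h.measurePreserving_evolutionMap hS h0 hU hL h0 hr
  -- (1) the pointwise bound in `[0,∞]`
  have hpt : ∀ a, ‖curl (u t) (X t a)‖ₑ ≤ ‖curl (u 0) a‖ₑ + ∫⁻ r in Ioc 0 t, G r (X r a) := by
    intro a
    have hreal := norm_curl_evolutionMap_le_of_classical_euler h hL ht a
    rw [intervalIntegral.integral_of_le ht] at hreal
    have hcont : ContinuousOn (fun r => 2 * F r (X r a)) (Icc 0 t) := by
      have hXa : ContinuousOn (fun r => X r a) (Ici (0 : ℝ)) := hL.continuousOn_evolutionMap hS h0 a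
      have hA : ContinuousOn (fun r => fderiv ℝ (u r) (X r a)) (Ici (0 : ℝ)) :=
        hgrad.comp (continuousOn_id.prodMk hXa) fun r hr => mk_mem_prod hr (mem_univ _)
      exact (continuousOn_const.mul (LerayHopfProofs.continuous_frobeniusNormSq.comp_continuousOn hA)).mono
        Icc_subset_Ici_self
    have hint : IntegrableOn (fun r => 2 * F r (X r a)) (Ioc 0 t) :=
      hcont.integrableOn_Icc.mono_set Ioc_subset_Icc_self
    have hnn : 0 ≤ᵐ[volume.restrict (Ioc 0 t)] fun r => 2 * F r (X r a) :=
      Eventually.of_forall fun r => mul_nonneg zero_le_two (frobeniusNormSq_nonneg _)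
    calc ‖curl (u t) (X t a)‖ₑ = ENNReal.ofReal ‖curl (u t) (X t a)‖ := (ofReal_norm _).symm
      _ ≤ ENNReal.ofReal (‖curl (u 0) a‖ + ∫ r in Ioc 0 t, 2 * F r (X r a)) := ENNReal.ofReal_le_ofReal hreal
      _ ≤ ENNReal.ofReal ‖curl (u 0) a‖ + ENNReal.ofReal (∫ r in Ioc 0 t, 2 * F r (X r a)) := ENNReal.ofReal_add_le
      _ = ‖curl (u 0) a‖ₑ + ∫⁻ r in Ioc 0 t, G r (X r a) := by
          rw [ofReal_norm, ofReal_integral_eq_lintegral_ofReal hint hnn]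
  -- (2) Tonelli and measure preservation for the double integral
  have hμ : (volume : Measure (EuclideanSpace ℝ (Fin 3))).prod ((volume : Measure ℝ).restrict (Ioc 0 t)) =
      ((volume : Measure (EuclideanSpace ℝ (Fin 3))).prod (volume : Measure ℝ)).restrict (univ ×ˢ Ioc 0 t) := by
    rw [← Measure.prod_restrict, Measure.restrict_univ]
  have hAEm : AEMeasurable (uncurry fun (a : EuclideanSpace ℝ (Fin 3)) (r : ℝ) => G r (X r a))
      ((volume : Measure (EuclideanSpace ℝ (Fin 3))).prod ((volume : Measure ℝ).restrict (Ioc 0 t))) := by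
    rw [hμ]
    refine ContinuousOn.aemeasurable ?_ (MeasurableSet.univ.prod measurableSet_Ioc)
    exact hGXsw.congr fun q _ => rfl
  have hswap : ∫⁻ a, ∫⁻ r in Ioc 0 t, G r (X r a) = ∫⁻ r in Ioc 0 t, ∫⁻ a, G r (X r a) :=
    lintegral_lintegral_swap hAEm
  have hinner : EqOn (fun r => ∫⁻ a, G r (X r a)) (fun r => ∫⁻ y, G r y) (Ioc 0 t) := fun r hr =>
    (hmp r (mem_Ici.2 hr.1.le)).lintegral_comp (hGmeas r (mem_Ici.2 hr.1.le))
  have hGae : AEMeasurable (fun z : ℝ × EuclideanSpace ℝ (Fin 3) => G z.1 z.2)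
      (((volume : Measure ℝ).prod (volume : Measure (EuclideanSpace ℝ (Fin 3)))).restrict
        (Ioc 0 t ×ˢ (univ : Set (EuclideanSpace ℝ (Fin 3))))) := by
    rw [← Measure.volume_eq_prod]
    exact (hGcont.mono (Set.prod_mono (fun r (hr : r ∈ Ioc (0 : ℝ) t) => mem_Ici.2 hr.1.le) le_rfl)).aemeasurable
      (measurableSet_Ioc.prod MeasurableSet.univ)
  have hprod : ∫⁻ z in Ioc 0 t ×ˢ (univ : Set (EuclideanSpace ℝ (Fin 3))), G z.1 z.2 =
      ∫⁻ r in Ioc 0 t, ∫⁻ y, G r y := by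
    rw [Measure.volume_eq_prod, setLIntegral_prod _ hGae]
    simp only [Measure.restrict_univ]
  have hconst : ∫⁻ z in Ioc 0 t ×ˢ (univ : Set (EuclideanSpace ℝ (Fin 3))), G z.1 z.2 =
      2 * ∫⁻ z in Ioc 0 t ×ˢ (univ : Set (EuclideanSpace ℝ (Fin 3))), ENNReal.ofReal (F z.1 z.2) := by
    rw [← lintegral_const_mul' _ _ ENNReal.ofNat_ne_top]
    refine lintegral_congr fun z => ?_
    rw [hG]
    simp only
    rw [ENNReal.ofReal_mul zero_le_two, ENNReal.ofReal_ofNat]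
  -- (3) assemble
  calc ∫⁻ x, ‖curl (u t) x‖ₑ = ∫⁻ a, ‖curl (u t) (X t a)‖ₑ :=
        ((hmp t htS).lintegral_comp (hωmeas t htS)).symm
    _ ≤ ∫⁻ a, (‖curl (u 0) a‖ₑ + ∫⁻ r in Ioc 0 t, G r (X r a)) := lintegral_mono hpt
    _ = (∫⁻ a, ‖curl (u 0) a‖ₑ) + ∫⁻ a, ∫⁻ r in Ioc 0 t, G r (X r a) := lintegral_add_left (hωmeas 0 h0) _
    _ = (∫⁻ a, ‖curl (u 0) a‖ₑ) + ∫⁻ r in Ioc 0 t, ∫⁻ y, G r y := by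
        rw [hswap, setLIntegral_congr_fun measurableSet_Ioc hinner]
    _ = (∫⁻ a, ‖curl (u 0) a‖ₑ) +
        2 * ∫⁻ z in Ioc 0 t ×ˢ (univ : Set (EuclideanSpace ℝ (Fin 3))), ENNReal.ofReal (F z.1 z.2) := by
        rw [← hprod, hconst]

end Lagrangian


/-! ## Part C — no classical Euler flow with integrable vorticity is relaxing -/

/-- **A uniform slice floor makes the space–time enstrophy infinite** (Tonelli on `(0,∞) × ℝ³`): for `v` jointly `C¹` on
`(0,∞) × ℝ³` with `φ₀ ≤ ∫ |∇v(s)|²_F` for every `s > 0`, `φ₀ ≠ 0`, one has `∫∫_{(0,∞)×ℝ³} |∇v|²_F = ∞`. [folklore] -/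
theorem setLIntegral_enstrophy_eq_top_of_sliceFloor
    {v : ℝ → EuclideanSpace ℝ (Fin 3) → EuclideanSpace ℝ (Fin 3)}
    (hv : ContDiffOn ℝ 1 (uncurry v) (Ioi (0 : ℝ) ×ˢ (univ : Set (EuclideanSpace ℝ (Fin 3)))))
    {φ₀ : ℝ≥0∞} (hφ₀ : φ₀ ≠ 0)
    (hslice : ∀ s : ℝ, 0 < s → φ₀ ≤ ∫⁻ x, ENNReal.ofReal (frobeniusNormSq (fderiv ℝ (v s) x))) :
    ∫⁻ z in Ioi (0 : ℝ) ×ˢ (univ : Set (EuclideanSpace ℝ (Fin 3))),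
      ENNReal.ofReal (frobeniusNormSq (fderiv ℝ (v z.1) z.2)) = ⊤ := by
  have hslice_cont : ContinuousOn (fun z : ℝ × EuclideanSpace ℝ (Fin 3) => fderiv ℝ (v z.1) z.2)
      (Ioi (0 : ℝ) ×ˢ (univ : Set (EuclideanSpace ℝ (Fin 3)))) :=
    continuousOn_fderiv_slice_of_contDiffOn hv isOpen_Ioi.uniqueDiffOn
  have hFcont : ContinuousOn
      (fun z : ℝ × EuclideanSpace ℝ (Fin 3) => ENNReal.ofReal (frobeniusNormSq (fderiv ℝ (v z.1) z.2)))
      (Ioi (0 : ℝ) ×ˢ (univ : Set (EuclideanSpace ℝ (Fin 3)))) :=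
    ENNReal.continuous_ofReal.comp_continuousOn
      (LerayHopfProofs.continuous_frobeniusNormSq.comp_continuousOn hslice_cont)
  have hmeas : MeasurableSet (Ioi (0 : ℝ) ×ˢ (univ : Set (EuclideanSpace ℝ (Fin 3)))) :=
    measurableSet_Ioi.prod MeasurableSet.univ
  have hF : AEMeasurable
      (fun z : ℝ × EuclideanSpace ℝ (Fin 3) => ENNReal.ofReal (frobeniusNormSq (fderiv ℝ (v z.1) z.2)))
      (((volume : Measure ℝ).prod (volume : Measure (EuclideanSpace ℝ (Fin 3)))).restrict
        (Ioi (0 : ℝ) ×ˢ (univ : Set (EuclideanSpace ℝ (Fin 3))))) := by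
    rw [← Measure.volume_eq_prod]
    exact hFcont.aemeasurable hmeas
  rw [Measure.volume_eq_prod, setLIntegral_prod _ hF]
  simp only [Measure.restrict_univ]
  refine eq_top_iff.2 ?_
  calc (⊤ : ℝ≥0∞) = φ₀ * volume (Ioi (0 : ℝ)) := by rw [Real.volume_Ioi, ENNReal.mul_top hφ₀]
    _ = ∫⁻ _ in Ioi (0 : ℝ), φ₀ := (setLIntegral_const _ _).symm
    _ ≤ ∫⁻ s in Ioi (0 : ℝ), ∫⁻ x, ENNReal.ofReal (frobeniusNormSq (fderiv ℝ (v s) x)) :=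
        setLIntegral_mono' measurableSet_Ioi fun s hs => hslice s hs

/-- **NO CLASSICAL EULER FLOW WITH INTEGRABLE VORTICITY IS RELAXING.**  Let `(u,p)` be a classical Euler flow on
`[0,∞) × ℝ³` whose velocity satisfies the Cauchy–Lipschitz hypotheses (`ODE.IsUniformlyLipschitzOn u (Ici 0)`), with
INTEGRABLE initial vorticity `∫‖curl u(0)‖ < ∞` (fat or thin — no support hypothesis), slices with `∫|u|², ∫|u|³, ∫|p||u|`
bounded locally uniformly on `(0,∞)` (energy conservation), positive energy at some time `s₀ > 0` and finite-enstrophy slices.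
Then the space–time enstrophy budget `∫∫_{(0,∞)×ℝ³}|∇u|²_F ≤ M` fails for every `M`: under the budget the vorticity mass stays
`≤ ∫‖curl u(0)‖ + 2M` (`lintegral_enorm_curl_le_of_classical_euler`), so by `energy_le_vorticityMass_enstrophy` the conserved
energy `E₀` forces the slice floor `∫|∇u(s)|²_F ≥ (E₀ / (C W^{4/3}))³ / 2 > 0`, which is not summable over `(0,∞)`.
Strictly contains `…Negative.VortexVolumeInvariant.no_relaxing_classicalEuler_of_compactVorticity` (compact support ⇒ `L¹`);
the forward refutation door (F) of X_E on the classical side is thereby reduced to data with NON-INTEGRABLE vorticity. [folklore] -/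
theorem no_relaxing_classicalEuler_of_integrableVorticity
    {u : ℝ → EuclideanSpace ℝ (Fin 3) → EuclideanSpace ℝ (Fin 3)} {p : ℝ → EuclideanSpace ℝ (Fin 3) → ℝ} {M : ℝ≥0}
    (h : IsClassicalEulerSolutionOn (Ici (0 : ℝ)) 0 u p) (hL : ODE.IsUniformlyLipschitzOn u (Ici (0 : ℝ)))
    (hω₁ : ∫⁻ x, ‖curl (u 0) x‖ₑ < ⊤)
    (hunif : ∀ a b : ℝ, 0 < a → a < b → ∃ M' : ℝ, ∀ τ ∈ Icc a b,
      (Integrable (fun y => ‖u τ y‖ ^ 2) ∧ ∫ y, ‖u τ y‖ ^ 2 ≤ M') ∧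
      (Integrable (fun y => ‖u τ y‖ ^ 3) ∧ ∫ y, ‖u τ y‖ ^ 3 ≤ M') ∧
      (Integrable (fun y => |p τ y| * ‖u τ y‖) ∧ ∫ y, |p τ y| * ‖u τ y‖ ≤ M'))
    {s₀ : ℝ} (hs₀ : 0 < s₀) (hpos : 0 < ∫ y, ‖u s₀ y‖ ^ 2)
    (hωfin : ∀ s : ℝ, 0 < s → ∫⁻ x, ‖curl (u s) x‖ₑ ^ 2 < ⊤)
    (hEns : ∫⁻ z in Ioi (0 : ℝ) ×ˢ (univ : Set (EuclideanSpace ℝ (Fin 3))),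
      ENNReal.ofReal (frobeniusNormSq (fderiv ℝ (u z.1) z.2)) ≤ (M : ℝ≥0∞)) : False := by
  have hsol : IsClassicalEulerSolutionOn (Ioi (0 : ℝ)) 0 u p :=
    h.mono Ioi_subset_Ici_self isOpen_Ioi.uniqueDiffOn
  -- energy: every slice is square integrable and the energy is constant `= ∫|u(s₀)|²`
  have hint : ∀ s : ℝ, 0 < s → Integrable (fun y => ‖u s y‖ ^ 2) := by
    intro s hs
    obtain ⟨M', hM'⟩ := hunif s (s + 1) hs (by linarith)
    exact (hM' s ⟨le_rfl, by linarith⟩).1.1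
  have hcons : ∀ s : ℝ, 0 < s → ∫ y, ‖u s y‖ ^ 2 = ∫ y, ‖u s₀ y‖ ^ 2 := by
    intro s hs
    rcases lt_trichotomy s s₀ with hlt | heq | hgt
    · obtain ⟨M', hM'⟩ := hunif s s₀ hs hlt
      exact (integral_norm_sq_eq_of_classical_euler_forward hsol hs hlt (fun τ hτ => (hM' τ hτ).1)
        (fun τ hτ => (hM' τ hτ).2.1) (fun τ hτ => (hM' τ hτ).2.2)).symm
    · rw [heq]
    · obtain ⟨M', hM'⟩ := hunif s₀ s hs₀ hgt
      exact integral_norm_sq_eq_of_classical_euler_forward hsol hs₀ hgt (fun τ hτ => (hM' τ hτ).1)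
        (fun τ hτ => (hM' τ hτ).2.1) (fun τ hτ => (hM' τ hτ).2.2)
  have hC2 : ∀ s : ℝ, 0 < s → ContDiff ℝ 2 (u s) := fun s hs =>
    (h.contDiff_velocity (show s ∈ Ici (0 : ℝ) from hs.le)).of_le (by norm_cast)
  have hdiv : ∀ s : ℝ, 0 < s → VectorCalculus.IsDivFree (u s) := fun s hs => h.divFree s hs.le
  have hfin : ∀ s : ℝ, 0 < s → ∫⁻ x, ‖u s x‖ₑ ^ 2 < ⊤ := by
    intro s hs
    rw [lintegral_enorm_sq_eq_ofReal_integral (hint s hs)]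
    exact ENNReal.ofReal_lt_top
  set E₀ : ℝ≥0∞ := ENNReal.ofReal (∫ y, ‖u s₀ y‖ ^ 2) with hE₀def
  have hE₀ : E₀ ≠ 0 := (ENNReal.ofReal_pos.2 hpos).ne'
  have hfloor : ∀ s : ℝ, 0 < s → E₀ ≤ ∫⁻ x, ‖u s x‖ₑ ^ 2 := by
    intro s hs
    rw [lintegral_enorm_sq_eq_ofReal_integral (hint s hs), hcons s hs]
  -- vorticity mass: `∫‖ω(s)‖ ≤ W := ∫‖ω₀‖ + 2M` for all `s > 0`
  set W : ℝ≥0∞ := (∫⁻ a, ‖curl (u 0) a‖ₑ) + 2 * (M : ℝ≥0∞) with hW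
  have hWtop : W ≠ ⊤ := ENNReal.add_ne_top.2 ⟨hω₁.ne, ENNReal.mul_ne_top ENNReal.ofNat_ne_top ENNReal.coe_ne_top⟩
  have hmass : ∀ s : ℝ, 0 < s → ∫⁻ x, ‖curl (u s) x‖ₑ ≤ W := by
    intro s hs
    refine (lintegral_enorm_curl_le_of_classical_euler h hL hs.le).trans ?_
    rw [hW]
    gcongr
    exact (lintegral_mono_set (Set.prod_mono Ioc_subset_Ioi_self le_rfl)).trans hEns
  -- slice enstrophy floor from the mass–enstrophy slaving of the conserved energy
  obtain ⟨C, hC⟩ := energy_le_vorticityMass_enstrophy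
  set K : ℝ≥0∞ := (C : ℝ≥0∞) * W ^ (4 / 3 : ℝ) with hK
  have hKtop : K ≠ ⊤ := ENNReal.mul_ne_top ENNReal.coe_ne_top (ENNReal.rpow_ne_top_of_nonneg (by norm_num) hWtop)
  set φ₀ : ℝ≥0∞ := (E₀ / K) ^ (3 : ℝ) / 2 with hφ₀def
  have hφ₀ : φ₀ ≠ 0 :=
    (ENNReal.div_pos_iff.2 ⟨(ENNReal.rpow_pos_of_nonneg (ENNReal.div_pos_iff.2 ⟨hE₀, hKtop⟩) (by norm_num)).ne',
      ENNReal.ofNat_ne_top⟩).ne'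
  have hslice : ∀ s : ℝ, 0 < s → φ₀ ≤ ∫⁻ x, ENNReal.ofReal (frobeniusNormSq (fderiv ℝ (u s) x)) := by
    intro s hs
    set Φ : ℝ≥0∞ := ∫⁻ x, ENNReal.ofReal (frobeniusNormSq (fderiv ℝ (u s) x)) with hΦ
    have hZ : ∫⁻ x, ‖curl (u s) x‖ₑ ^ 2 ≤ 2 * Φ := lintegral_enorm_curl_sq_le_two_mul (u s)
    have hE : E₀ ≤ K * (2 * Φ) ^ (1 / 3 : ℝ) :=
      calc E₀ ≤ ∫⁻ x, ‖u s x‖ₑ ^ 2 := hfloor s hs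
        _ ≤ (C : ℝ≥0∞) * (∫⁻ x, ‖curl (u s) x‖ₑ) ^ (4 / 3 : ℝ) * (∫⁻ x, ‖curl (u s) x‖ₑ ^ 2) ^ (1 / 3 : ℝ) :=
            hC (u s) (hC2 s hs) (hdiv s hs) (hfin s hs) (hωfin s hs)
        _ ≤ (C : ℝ≥0∞) * W ^ (4 / 3 : ℝ) * (2 * Φ) ^ (1 / 3 : ℝ) :=
            mul_le_mul' (mul_le_mul' le_rfl (ENNReal.rpow_le_rpow (hmass s hs) (by norm_num)))
              (ENNReal.rpow_le_rpow hZ (by norm_num))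
        _ = K * (2 * Φ) ^ (1 / 3 : ℝ) := by rw [hK]
    have h1 : E₀ / K ≤ (2 * Φ) ^ (1 / 3 : ℝ) := ENNReal.div_le_of_le_mul (by rwa [mul_comm] at hE)
    have h2 : (E₀ / K) ^ (3 : ℝ) ≤ 2 * Φ := by
      have h3 := ENNReal.rpow_le_rpow h1 (show (0 : ℝ) ≤ 3 by norm_num)
      rwa [← ENNReal.rpow_mul, show (1 / 3 : ℝ) * 3 = 1 by norm_num, ENNReal.rpow_one] at h3
    exact ENNReal.div_le_of_le_mul (by rwa [mul_comm] at h2)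
  -- Tonelli: the space–time enstrophy is infinite
  have hv : ContDiffOn ℝ 1 (uncurry u) (Ioi (0 : ℝ) ×ˢ (univ : Set (EuclideanSpace ℝ (Fin 3)))) := by
    have hvInf : ContDiffOn ℝ (⊤ : ℕ∞) (uncurry u) (Ioi (0 : ℝ) ×ˢ (univ : Set (EuclideanSpace ℝ (Fin 3)))) :=
      hsol.smooth_velocity
    exact hvInf.of_le (by norm_cast)
  have htop := setLIntegral_enstrophy_eq_top_of_sliceFloor hv hφ₀ hslice
  rw [htop] at hEns
  exact ENNReal.coe_ne_top (top_le_iff.1 hEns)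

end Summit.NavierStokesRegularity.NavierStokesRegularity.Theorems.PowerGaugeEulerLiouville.Negative
end
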